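import Literature.Analysis.FluidPDE.LerayHopfMomentum
import HarnessLib

/-!
# Leray–Hopf solutions with a steady mean-zero `L²` force: uniform energy bound at any momentum

Analysis/FluidPDE support file (all proved), continuation of
`Literature/Analysis/FluidPDE/LerayHopfMomentum`. `Literature/Analysis/FluidPDE/LerayHopfUniformEnergy`
proves the trajectory bound `sup_{t ≥ 0} ‖u(t)‖₂ < ∞` (FMRT 2001, Ch. II App. A (A.40)–(A.42),
Ch. IV (3.2)) for global Leray–Hopf solutions on `T^d` whose slices have ZERO MEAN; here the
zero-mean hypothesis on the solution is traded for a zero-mean hypothesis on the steady force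
`F ∈ L²` (the momentum `m = ∫u(τ)` is then conserved for `τ > 0` and Poincaré with mean replaces
Poincaré):

* `Torus.IsGlobalLerayHopf.exists_forall_integral_norm_sq_le_of_hasZeroMean` — FMRT (3.2),
  qualitative: `∃ R, ∀ t ≥ 0, ∫‖u(t)‖² ≤ R` (the restarted integral inequality
  `y(t) + ν ∫_{(s,t]} y ≤ y(s) + C(t - s)` with `C = |F|²/ν + ν‖m‖²`, fed to
  `Literature.Analysis.FluidPDE.exists_forall_le_of_restart`);
* `Torus.IsGlobalLerayHopf.isBoundedUnder_timeMean_energy` — hence the running means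
  `T⁻¹∫₀ᵀ ∫‖u‖²` are eventually bounded (the long-time mean energy is an honest `limsup`).

## References

* C. Foias, O. Manley, R. Rosa, R. Temam, *Navier–Stokes Equations and Turbulence*, CUP 2001,
  Ch. II App. A (A.38)–(A.42); Ch. IV §3.1 (3.2), (3.4). [FMRT2001]
-/

noncomputable section

open _root_.MeasureTheory _root_.Set _root_.Filter _root_.Topology UnitAddTorus
open scoped InnerProductSpace RealInnerProductSpace ENNReal NNReal

namespace Literature.Analysis.FluidPDE.Torus

variable {d : Type*} [Fintype d] [DecidableEq d]

section Energy

variable {ν : ℝ} {F u₀ : UnitAddTorus d → EuclideanSpace ℝ d} {u : ℝ → UnitAddTorus d → EuclideanSpace ℝ d}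

/-- **The trajectory is bounded in `L²` uniformly in time, any momentum** (FMRT 2001, (3.2)/(A.42),
qualitative form): for a global Leray–Hopf solution on `T^d` with viscosity `ν > 0` and steady
mean-zero force `F ∈ L²`, there is `R` with `∫ ‖u(t)‖² ≤ R` for every `t ≥ 0`. Proof: the
momentum `m = ∫u(τ)` is conserved for `τ > 0`; Poincaré with mean gives
`∫_{(s,t]} |u|² ≤ ∫ₛᵗ ‖∇u‖² + ‖m‖²(t - s)`, so the processed energy inequalities from `0` and from
a.e. `s > 0` yield the restarted integral inequality `y(t) + ν ∫_{(s,t]} y ≤ y(s) + C(t - s)` with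
`C = |F|²/ν + ν‖m‖²`, to which `Literature.Analysis.FluidPDE.exists_forall_le_of_restart` applies. [cite: FMRT2001, Ch. IV §3.1 (3.2)] -/
theorem IsGlobalLerayHopf.exists_forall_integral_norm_sq_le_of_hasZeroMean (hν : 0 < ν) (hF : MemLp F 2 volume)
    (hF0 : FunctionSpaces.Torus.HasZeroMean F) (hu : IsGlobalLerayHopf ν (fun _ => F) u₀ u) :
    ∃ R : ℝ, ∀ t, 0 ≤ t → ∫ x, ‖u t x‖ ^ 2 ≤ R := by
  classical
  set m : EuclideanSpace ℝ d := ∫ x, u 1 x with hm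
  set C₀ : ℝ := (∫ x, ‖F x‖ ^ 2) / ν with hC₀
  have hC₀0 : 0 ≤ C₀ := div_nonneg (integral_nonneg fun x => sq_nonneg _) hν.le
  set C : ℝ := C₀ + ν * ‖m‖ ^ 2 with hC
  have hC0 : 0 ≤ C := add_nonneg hC₀0 (by positivity)
  set E₀ : ℝ := 2 * FunctionSpaces.Torus.kineticEnergy u₀ with hE₀
  have hE₀0 : 0 ≤ E₀ := mul_nonneg zero_le_two (FunctionSpaces.Torus.kineticEnergy_nonneg _)
  -- the energy with `y 0` read as `|u₀|²`
  set y : ℝ → ℝ := fun t => if t = 0 then E₀ else ∫ x, ‖u t x‖ ^ 2 with hy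
  have hy_of_pos : ∀ t, 0 < t → y t = ∫ x, ‖u t x‖ ^ 2 := fun t ht => by simp [hy, ht.ne']
  have hy0 : ∀ t, 0 ≤ y t := fun t => by
    by_cases ht : t = 0
    · simp [hy, ht, hE₀0]
    · simp only [hy, ht, if_false]; exact integral_nonneg fun x => sq_nonneg _
  have hyI : ∀ s t, 0 ≤ s → ∫ τ in Ioc s t, y τ = ∫ τ in Ioc s t, (∫ x, ‖u τ x‖ ^ 2) :=
    fun s t hs => setIntegral_congr_fun measurableSet_Ioc fun τ hτ => hy_of_pos τ (hs.trans_lt hτ.1)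
  have hyi : ∀ T, IntegrableOn y (Ioc 0 T) := by
    intro T
    rcases le_or_gt T 0 with hT | hT
    · rw [Ioc_eq_empty (not_lt.2 hT)]
      exact integrableOn_empty
    · exact (hu.integrableOn_integral_norm_sq hT).congr_fun (fun τ hτ => (hy_of_pos τ hτ.1).symm) measurableSet_Ioc
  -- Poincaré with mean, integrated in time: `∫_{(s,t]} |u|² ≤ D(s,t) + ‖m‖²(t-s)`
  have hP : ∀ s t, 0 ≤ s → s ≤ t →
      ∫ τ in Ioc s t, (∫ x, ‖u τ x‖ ^ 2) ≤ (∫⁻ τ in Ioo s t, FunctionSpaces.Torus.eGradNormSq (u τ)).toReal + ‖m‖ ^ 2 * (t - s) := by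
    intro s t hs hst
    have hLH := hu (t + 1) (by linarith)
    have hsub : Ioo s t ⊆ Ioo 0 (t + 1) := Ioo_subset_Ioo hs (by linarith)
    have hmeas : AEMeasurable (fun τ => FunctionSpaces.Torus.eGradNormSq (u τ)) (volume.restrict (Ioo s t)) :=
      hLH.aemeasurable_eGradNormSq.mono_measure (Measure.restrict_mono hsub le_rfl)
    have hfin : ∫⁻ τ in Ioo s t, FunctionSpaces.Torus.eGradNormSq (u τ) < ⊤ :=
      (lintegral_mono_set hsub).trans_lt hLH.lintegral_eGradNormSq_lt_top
    have hlt : ∀ᵐ τ ∂(volume.restrict (Ioo s t)), FunctionSpaces.Torus.eGradNormSq (u τ) < ⊤ := ae_lt_top' hmeas hfin.ne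
    have hyi' : IntegrableOn (fun τ => ∫ x, ‖u τ x‖ ^ 2) (Ioo s t) := by
      rcases eq_or_lt_of_le (hs.trans hst) with ht0 | ht0
      · have : Ioo s t = ∅ := Ioo_eq_empty (by rw [← ht0]; exact not_lt.2 hs)
        rw [this]; exact integrableOn_empty
      · exact ((hu.integrableOn_integral_norm_sq ht0).mono_set (Ioc_subset_Ioc_left hs)).mono_set Ioo_subset_Ioc_self
    rw [setIntegral_congr_set (Ioo_ae_eq_Ioc (μ := volume) (a := s) (b := t)).symm, ← integral_toReal hmeas hlt]
    have hci : IntegrableOn (fun _ : ℝ => ‖m‖ ^ 2) (Ioo s t) := integrableOn_const (hs := measure_Ioo_lt_top.ne)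
    have hsum : (∫ τ in Ioo s t, (FunctionSpaces.Torus.eGradNormSq (u τ)).toReal) + ‖m‖ ^ 2 * (t - s) =
        ∫ τ in Ioo s t, ((FunctionSpaces.Torus.eGradNormSq (u τ)).toReal + ‖m‖ ^ 2) := by
      rw [integral_add (integrable_toReal_of_lintegral_ne_top hmeas hfin.ne) hci, setIntegral_const,
        Real.volume_real_Ioo_of_le hst, smul_eq_mul, mul_comm]
    rw [hsum]
    refine integral_mono_ae hyi' ((integrable_toReal_of_lintegral_ne_top hmeas hfin.ne).add hci) ?_
    filter_upwards [hlt, ae_restrict_mem measurableSet_Ioo] with τ hτ hτm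
    have hτ0 : 0 < τ := hs.trans_lt hτm.1
    have hmom : ∫ x, u τ x = m := hu.integral_eq_integral_of_hasZeroMean hF hF0 one_pos hτ0
    have h := integral_norm_sq_le_add_toReal_eGradNormSq (hu.memLp_two hτ0.le) hτ.ne
    rw [hmom] at h
    linarith
  -- the good initial times
  set G : Set ℝ := {s | 0 ≤ s ∧ ∀ t, s ≤ t → y t + ν * ∫ τ in Ioc s t, y τ ≤ y s + C * (t - s)} with hG
  have h0 : (0 : ℝ) ∈ G := by
    refine ⟨le_rfl, fun t ht => ?_⟩
    rcases eq_or_lt_of_le ht with ht0 | ht0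
    · subst ht0; simp
    · have hE := (hu (t + 1) (by linarith)).energy_ineq_zero t ⟨ht, by linarith⟩
      have h := hu.norm_sq_add_dissipation_le_of_hasZeroMean hν hF hF0 le_rfl ht hE
      have hPt := hP 0 t le_rfl ht
      rw [hyI 0 t le_rfl, hy_of_pos t ht0]
      have hy00 : y 0 = E₀ := by simp [hy]
      rw [hy00]
      rw [sub_zero] at h hPt
      nlinarith [hν, h, hPt, sq_nonneg ‖m‖]
  have hG' : ∀ᵐ s ∂volume, 0 < s → s ∈ G := by
    have hn : ∀ n : ℕ, ∀ᵐ s ∂volume, s ∈ Ioo (0 : ℝ) (n + 1) → ∀ t ∈ Icc s ((n : ℝ) + 1),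
        FunctionSpaces.Torus.kineticEnergy (u t) +
            ν * (∫⁻ τ in Ioo s t, FunctionSpaces.Torus.eGradNormSq (u τ)).toReal ≤
          FunctionSpaces.Torus.kineticEnergy (u s) + ∫ τ in s..t, ∫ x, ⟪F x, u τ x⟫ := fun n =>
      (ae_restrict_iff' measurableSet_Ioo).1 (hu ((n : ℝ) + 1) (by positivity)).energy_ineq_ae
    rw [← ae_all_iff] at hn
    filter_upwards [hn] with s hs hs0
    refine ⟨hs0.le, fun t hst => ?_⟩
    obtain ⟨n, hn'⟩ := exists_nat_gt t
    have hE := hs n ⟨hs0, by linarith⟩ t ⟨hst, by linarith⟩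
    have h := hu.norm_sq_add_dissipation_le_of_hasZeroMean hν hF hF0 hs0.le hst hE
    have hPt := hP s t hs0.le hst
    rw [hyI s t hs0.le, hy_of_pos t (hs0.trans_le hst), hy_of_pos s hs0]
    have hkin : FunctionSpaces.Torus.kineticEnergy (u s) = 2⁻¹ * ∫ x, ‖u s x‖ ^ 2 := rfl
    rw [hkin] at h
    nlinarith [hν, h, hPt, sq_nonneg ‖m‖]
  obtain ⟨R, hR⟩ := exists_forall_le_of_restart hν hC0 hy0 hyi (fun s hs => hs.1) h0 hG'
    (fun s hs t hst => hs.2 t hst)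
  refine ⟨R, fun t ht => ?_⟩
  rcases eq_or_lt_of_le ht with ht0 | ht0
  · subst ht0
    have hE := (hu 1 one_pos).energy_ineq_zero 0 ⟨le_rfl, zero_le_one⟩
    rw [intervalIntegral.integral_same, add_zero] at hE
    have hD : 0 ≤ ν * (∫⁻ τ in Ioo (0 : ℝ) 0, FunctionSpaces.Torus.eGradNormSq (u τ)).toReal :=
      mul_nonneg hν.le ENNReal.toReal_nonneg
    have hkin : FunctionSpaces.Torus.kineticEnergy (u 0) = 2⁻¹ * ∫ x, ‖u 0 x‖ ^ 2 := rfl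
    have hkin0 : FunctionSpaces.Torus.kineticEnergy u₀ = 2⁻¹ * E₀ := by rw [hE₀]; ring
    have hR0 := hR 0 le_rfl
    have hy00 : y 0 = E₀ := by simp [hy]
    rw [hy00] at hR0
    rw [hkin, hkin0] at hE
    linarith
  · rw [← hy_of_pos t ht0]
    exact hR t ht

/-- **The running means of the energy are bounded**: along a global Leray–Hopf solution with
steady mean-zero force `F ∈ L²` and `ν > 0`, the Cesàro means `T⁻¹∫₀ᵀ ∫‖u(t)‖² dt` are
eventually bounded (so the long-time mean energy `meanEnergy u` is an honest `limsup`). [folklore] -/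
theorem IsGlobalLerayHopf.isBoundedUnder_timeMean_energy (hν : 0 < ν) (hF : MemLp F 2 volume)
    (hF0 : FunctionSpaces.Torus.HasZeroMean F) (hu : IsGlobalLerayHopf ν (fun _ => F) u₀ u) :
    IsBoundedUnder (· ≤ ·) atTop (timeMean fun t => ∫ x, ‖u t x‖ ^ 2) := by
  obtain ⟨R, hR⟩ := hu.exists_forall_integral_norm_sq_le_of_hasZeroMean hν hF hF0
  refine isBoundedUnder_le_timeMean (C := R) fun t ht => ?_
  rw [abs_of_nonneg (integral_nonneg fun x => sq_nonneg _)]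
  exact hR t ht.le

end Energy

end Literature.Analysis.FluidPDE.Torus

end
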